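import Summits.ResolutionOfSingularities.ResolutionOfSingularities.Theorems.EquisingularLiftEquisingularLiftNatExactShadowELNat
import HarnessLib

/-!
# [OURS · L1 W4.5(b) · EL♮] T-EXACT-SHADOW with REGULAR CENTRES — the non-vacuous form of the CJS shadow
# (res-L1-w45b-lead-2's TARGET (6) 2026-08-27T07:06:48Z, file 3; repairs the strength of file 2's `Adm := ⊤` corollaries)

Crux `EquisingularLiftNat` = stmt-ResolutionOfSingularities-20038 (route EquisingularLift), line `sections`; helper file
`--supports … --as helper` by res-D-pv-037. HONEST FRAMING: OURS (cell res-hironaka, slot W4.5(b)); NOT a statement of any manuscript;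
a CONDITIONAL rung (the exact-lift hypothesis `(MS)` and the downstairs resolution `(DOWN)` are explicit binders). AI-written, weaker
than expert review. No `sorry`; standard axioms.

WHY THIS FILE. In file 2 (`…NatExactShadowELNat.lean`) the corollaries `elNatOver_of_isSingularBlowupSequence` /
`elNatAt_of_isSingularBlowupSequence` take `Adm := ⊤`, so their lift hypothesis `(MS)` asks for an exact admissible lift of EVERY
ideal sheaf supported in the non-regular locus — e.g. of `𝔪_z²` at a singular closed point `z` of `H`, which has none (an exact lift
`C` with `V(C)` regular is generated near `z` by part of a regular system of parameters of `𝒪_{ℙⁿ_O,z}` lying in `𝔪² + (ϖ)`, hence is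
principal there, while `𝔪²_{H,z}` is not, `n ≥ 2`). Those corollaries are therefore only the literal match to the Literature structure
`IsSingularBlowupSequence` (which does not record the regularity of the centres) and carry no content for singular `H`. The honest CJS
shadow restricts the centres to REGULAR closed subschemes of the singular locus (Cossart–Jannsen–Saito's permissible centres are
regular): `Adm Γ D := Scheme.IsRegular D.subscheme`.

* `isRegular_subscheme_comap_inv` — `Adm := «V(D) regular»` is iso-invariant (`(D.comap e.inv).subscheme ≅ V(D)`, Mathlib `comapIso`).
* `horizChainE1_of_regularCentreShadow` — the engine `horizChainE1_of_exactShadow` (file 1, p509671) at this `Adm`, from any stage.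
* `elNatOver_of_regularCentreSequence` / `elNatAt_of_regularCentreSequence` — item spelling, any `n`, fixed `(O, π)`: `(DOWN)` `H` reaches
  a regular scheme by finitely many blow-ups along ideal sheaves `D` with `V(D)` REGULAR and `supp D ⊆ Sing`; `(MS)` at every
  horizontal-E1 stage every such `D` on the reduced strict transform has an exact admissible lift (regular, `O`-flat, E1, `C.comap ι = D`)
  — for `D` the maximal ideal of a closed point this is a (multi)section with trace `𝔪_z` (lead-2's T-MULTISEC), for `D` the ideal of a
  regular curve it is an embedded LIFT of that curve; CONCLUSION `Theorems.EquisingularLift.ELNatOver p k n H ι O π`.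

References: …NatExactShadow.lean (p509671), …NatExactShadowELNat.lean (p510833); Cossart–Jannsen–Saito, LNM 2270 (2020), Introduction
Thm. 1 (permissible = regular and normally flat); Liu 2002 §8.1; L/w45b/CHAIN.md v7.2; LEAD-MEMO-2 §8 (CJS shadow programme).
-/

set_option linter.dupNamespace false -- mandated namespace `Summit.<Summit>.<Problem>` of this single-conjunct summit
set_option linter.overlappingInstances false -- signatures carry `[IsDomain O] [IsDiscreteValuationRing O]`

noncomputable section

open CategoryTheory CategoryTheory.Limits AlgebraicGeometry TopologicalSpace Topology
open MvPolynomial HomogeneousIdeal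
open Literature.AlgebraicGeometry.Resolution
open AlgebraicGeometry.Scheme.IdealSheafData
open Summit.ResolutionOfSingularities.ResolutionOfSingularities.Theses.EquisingularLift.Split
open Summit.ResolutionOfSingularities.ResolutionOfSingularities.Cruxes.EquisingularLift.StrataSplit

namespace Summit.ResolutionOfSingularities.ResolutionOfSingularities.Cruxes.EquisingularLiftNat.Sections

universe u

/-- Regularity of the closed subscheme `V(D)` is invariant under transport of `D` along an isomorphism of schemes:
`V(D.comap e.inv) ≅ Γ' ×_Γ V(D) ≅ V(D)`. [folklore] -/
theorem isRegular_subscheme_comap_inv {Γ Γ' : Scheme.{u}} (e : Γ ≅ Γ') (D : Γ.IdealSheafData)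
    (hD : Scheme.IsRegular D.subscheme) : Scheme.IsRegular (D.comap e.inv).subscheme :=
  Scheme.IsRegular.of_iso (inv (pullback.snd e.inv D.subschemeι) ≫ (D.comapIso e.inv).inv) hD

/-- **T-EXACT-SHADOW WITH REGULAR CENTRES, from any stage**: the engine `horizChainE1_of_exactShadow` (file 1) at
`Adm Γ D := «V(D) regular»`. [folklore; Liu 2002 §8.1] -/
theorem horizChainE1_of_regularCentreShadow (O : Type) [CommRing O] [IsDomain O] [IsDiscreteValuationRing O]
    (P : Scheme.{0}) (q : P ⟶ Spec (.of O)) (Y : Closeds P)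
    (Ch : ∀ X' : Scheme.{0}, (X' ⟶ P) → Set X' → Prop)
    (hChain : ∀ (X' : Scheme.{0}) (σ : X' ⟶ P) (S : Set X'), Ch X' σ S → Chain P (Y : Set P) X' σ S)
    (hStep : ∀ (X' X'' : Scheme.{0}) (σ' : X' ⟶ P) (S' : Set X') (C : X'.IdealSheafData) (τ : X'' ⟶ X'),
      Ch X' σ' S' → IsBlowup τ C → Scheme.IsRegular C.subscheme → Flat (C.subschemeι ≫ σ' ≫ q) →
      σ' '' (C.support : Set X') ⊆ {x : P | ¬ IsGenericPoint x (Y : Set P)} →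
      (C.support : Set X') ∩ (σ' ≫ q) ⁻¹' {IsLocalRing.closedPoint O} ⊆ S' →
      Ch X'' (τ ≫ σ') (closure (τ ⁻¹' (S' \ (C.support : Set X')))))
    (hq : Smooth q) (hqp : IsProper q)
    (hY : (Y : Set P) ⊆ q ⁻¹' {IsLocalRing.closedPoint O}) (hYirr : IsIrreducible (Y : Set P))
    -- (MS) exact admissible lifts of regular centres exist
    (hMS : ∀ (X₁ : Scheme.{0}) (σ₁ : X₁ ⟶ P) (S₁ : Set X₁), Ch X₁ σ₁ S₁ → IsLocallyNoetherian X₁ →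
      Scheme.IsRegular X₁ → IsProper (σ₁ ≫ q) → IsClosed S₁ → IsIrreducible S₁ →
      S₁ ⊆ (σ₁ ≫ q) ⁻¹' {IsLocalRing.closedPoint O} →
      ∀ D : ((vanishingIdeal (⟨closure S₁, isClosed_closure⟩ : Closeds X₁)).subscheme).IdealSheafData,
        (D.support : Set ↥(vanishingIdeal (⟨closure S₁, isClosed_closure⟩ : Closeds X₁)).subscheme) ⊆
          (Scheme.regularLocus (vanishingIdeal (⟨closure S₁, isClosed_closure⟩ : Closeds X₁)).subscheme)ᶜ →
        Scheme.IsRegular D.subscheme →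
        ∃ C : X₁.IdealSheafData, Scheme.IsRegular C.subscheme ∧ Flat (C.subschemeι ≫ σ₁ ≫ q) ∧
          (C.support : Set X₁) ∩ (σ₁ ≫ q) ⁻¹' {IsLocalRing.closedPoint O} ⊆ S₁ ∧
          C.comap (vanishingIdeal (⟨closure S₁, isClosed_closure⟩ : Closeds X₁)).subschemeι = D)
    -- the starting stage and the downstairs resolution by blow-ups at regular centres inside the singular loci
    (X' : Scheme.{0}) (σ' : X' ⟶ P) (S' : Set X') (hCh : Ch X' σ' S')
    (Γ : Scheme.{0}) (e : Γ ≅ (vanishingIdeal (⟨closure S', isClosed_closure⟩ : Closeds X')).subscheme)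
    (hdown : ∃ Γs : Scheme.{0}, (∀ R : Scheme.{0} → Prop, R Γ →
      (∀ (Γ₁ Γ₂ : Scheme.{0}) (D : Γ₁.IdealSheafData) (υ : Γ₂ ⟶ Γ₁), R Γ₁ →
        (D.support : Set Γ₁) ⊆ (Scheme.regularLocus Γ₁)ᶜ → Scheme.IsRegular D.subscheme → IsBlowup υ D → R Γ₂) → R Γs) ∧
      Scheme.IsRegular Γs) :
    ∃ (X'' : Scheme.{0}) (σ'' : X'' ⟶ P) (S'' : Set X''), Ch X'' σ'' S'' ∧
      Scheme.IsRegular (vanishingIdeal (⟨closure S'', isClosed_closure⟩ : Closeds X'')).subscheme :=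
  horizChainE1_of_exactShadow O P q Y Ch hChain hStep hq hqp hY hYirr (fun _ D => Scheme.IsRegular D.subscheme)
    (fun _ _ e D hD => isRegular_subscheme_comap_inv e D hD) hMS X' σ' S' hCh Γ e hdown

/-- **`ELNatOver` FROM A DOWNSTAIRS RESOLUTION BY BLOW-UPS AT REGULAR CENTRES INSIDE THE SINGULAR LOCI, WITH EXACT ADMISSIBLE LIFTS**
(the non-vacuous CJS shadow; see the module docstring): `elNatOver_of_exactShadow` (file 2, p510833) at `Adm Γ D := «V(D) regular»`.
[folklore; Liu 2002 §8.1] -/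
theorem elNatOver_of_regularCentreSequence {p : ℕ} (k : Type) [Field k] [CharP k p] [IsAlgClosed k] (n : ℕ)
    (H : Scheme.{0}) (ι : H ⟶ (Literature.AlgebraicGeometry.Motives.projectiveSpace n k).left) [IsClosedImmersion ι]
    [IsIntegral H] (O : Type) [CommRing O] [IsDomain O] [IsDiscreteValuationRing O] [CharZero O] (π : O →+* k)
    (hπ : Function.Surjective π)
    (hdown : ∃ Γs : Scheme.{0}, (∀ R : Scheme.{0} → Prop, R H →
      (∀ (Γ₁ Γ₂ : Scheme.{0}) (D : Γ₁.IdealSheafData) (υ : Γ₂ ⟶ Γ₁), R Γ₁ →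
        (D.support : Set Γ₁) ⊆ (Scheme.regularLocus Γ₁)ᶜ → Scheme.IsRegular D.subscheme → IsBlowup υ D → R Γ₂) → R Γs) ∧
      Scheme.IsRegular Γs)
    (hMS : letI := MvPolynomial.gradedAlgebra (σ := Fin (n + 1)) (R := O);
      letI := MvPolynomial.gradedAlgebra (σ := Fin (n + 1)) (R := k);
      ∀ (φ : homogeneousSubmodule (Fin (n + 1)) O →+*ᵍ homogeneousSubmodule (Fin (n + 1)) k)
        (hφ' : HomogeneousIdeal.irrelevant (homogeneousSubmodule (Fin (n + 1)) k) ≤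
          (HomogeneousIdeal.irrelevant (homogeneousSubmodule (Fin (n + 1)) O)).map φ),
        (∀ s, φ s = MvPolynomial.map π s) →
      ∀ (X₁ : Scheme.{0}) (σ₁ : X₁ ⟶ Proj (homogeneousSubmodule (Fin (n + 1)) O)) (S₁ : Set X₁),
        (∀ Q : (∀ X' : Scheme.{0}, (X' ⟶ Proj (homogeneousSubmodule (Fin (n + 1)) O)) → Set X' → Prop),
          Q (Proj (homogeneousSubmodule (Fin (n + 1)) O)) (𝟙 _) (Set.range (ι ≫ Proj.map φ hφ')) →
          (∀ (X' X'' : Scheme.{0}) (σ' : X' ⟶ Proj (homogeneousSubmodule (Fin (n + 1)) O)) (Y' : Set X')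
            (C : X'.IdealSheafData) (τ : X'' ⟶ X'), Q X' σ' Y' → IsBlowup τ C → Scheme.IsRegular C.subscheme →
            Flat (C.subschemeι ≫ σ' ≫ Proj.toSpecZero (homogeneousSubmodule (Fin (n + 1)) O) ≫
              Spec.map (CommRingCat.ofHom (algebraMap O (homogeneousSubmodule (Fin (n + 1)) O 0)))) →
            σ' '' (C.support : Set X') ⊆ {x | ¬ IsGenericPoint x (Set.range (ι ≫ Proj.map φ hφ'))} →
            (C.support : Set X') ∩ (σ' ≫ Proj.toSpecZero (homogeneousSubmodule (Fin (n + 1)) O) ≫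
              Spec.map (CommRingCat.ofHom (algebraMap O (homogeneousSubmodule (Fin (n + 1)) O 0)))) ⁻¹'
              {IsLocalRing.closedPoint O} ⊆ Y' →
            Q X'' (τ ≫ σ') (closure (τ ⁻¹' (Y' \ (C.support : Set X'))))) → Q X₁ σ₁ S₁) →
        IsLocallyNoetherian X₁ → Scheme.IsRegular X₁ →
        IsProper (σ₁ ≫ Proj.toSpecZero (homogeneousSubmodule (Fin (n + 1)) O) ≫
          Spec.map (CommRingCat.ofHom (algebraMap O (homogeneousSubmodule (Fin (n + 1)) O 0)))) →
        IsClosed S₁ → IsIrreducible S₁ →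
        S₁ ⊆ (σ₁ ≫ Proj.toSpecZero (homogeneousSubmodule (Fin (n + 1)) O) ≫
          Spec.map (CommRingCat.ofHom (algebraMap O (homogeneousSubmodule (Fin (n + 1)) O 0)))) ⁻¹'
          {IsLocalRing.closedPoint O} →
        ∀ D : ((vanishingIdeal (⟨closure S₁, isClosed_closure⟩ : Closeds X₁)).subscheme).IdealSheafData,
          (D.support : Set ↥(vanishingIdeal (⟨closure S₁, isClosed_closure⟩ : Closeds X₁)).subscheme) ⊆
            (Scheme.regularLocus (vanishingIdeal (⟨closure S₁, isClosed_closure⟩ : Closeds X₁)).subscheme)ᶜ →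
          Scheme.IsRegular D.subscheme →
          ∃ C : X₁.IdealSheafData, Scheme.IsRegular C.subscheme ∧
            Flat (C.subschemeι ≫ σ₁ ≫ Proj.toSpecZero (homogeneousSubmodule (Fin (n + 1)) O) ≫
              Spec.map (CommRingCat.ofHom (algebraMap O (homogeneousSubmodule (Fin (n + 1)) O 0)))) ∧
            (C.support : Set X₁) ∩ (σ₁ ≫ Proj.toSpecZero (homogeneousSubmodule (Fin (n + 1)) O) ≫
              Spec.map (CommRingCat.ofHom (algebraMap O (homogeneousSubmodule (Fin (n + 1)) O 0)))) ⁻¹'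
              {IsLocalRing.closedPoint O} ⊆ S₁ ∧
            C.comap (vanishingIdeal (⟨closure S₁, isClosed_closure⟩ : Closeds X₁)).subschemeι = D) :
    Theorems.EquisingularLift.ELNatOver p k n H ι O π :=
  elNatOver_of_exactShadow k n H ι O π hπ (fun _ D => Scheme.IsRegular D.subscheme)
    (fun _ _ e D hD => isRegular_subscheme_comap_inv e D hD) hdown hMS

/-- **`ELNatAt` FROM A DOWNSTAIRS RESOLUTION BY BLOW-UPS AT REGULAR CENTRES INSIDE THE SINGULAR LOCI, WITH EXACT ADMISSIBLE LIFTS** —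
the same packaged with `elNatAt_of_elNatOver`. [folklore] -/
theorem elNatAt_of_regularCentreSequence {p : ℕ} (k : Type) [Field k] [CharP k p] [IsAlgClosed k] (n : ℕ)
    (H : Scheme.{0}) (ι : H ⟶ (Literature.AlgebraicGeometry.Motives.projectiveSpace n k).left) [IsClosedImmersion ι]
    [IsIntegral H] (O : Type) [CommRing O] [IsDomain O] [IsDiscreteValuationRing O] [CharZero O] (π : O →+* k)
    (hπ : Function.Surjective π)
    (hdown : ∃ Γs : Scheme.{0}, (∀ R : Scheme.{0} → Prop, R H →
      (∀ (Γ₁ Γ₂ : Scheme.{0}) (D : Γ₁.IdealSheafData) (υ : Γ₂ ⟶ Γ₁), R Γ₁ →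
        (D.support : Set Γ₁) ⊆ (Scheme.regularLocus Γ₁)ᶜ → Scheme.IsRegular D.subscheme → IsBlowup υ D → R Γ₂) → R Γs) ∧
      Scheme.IsRegular Γs)
    (hMS : letI := MvPolynomial.gradedAlgebra (σ := Fin (n + 1)) (R := O);
      letI := MvPolynomial.gradedAlgebra (σ := Fin (n + 1)) (R := k);
      ∀ (φ : homogeneousSubmodule (Fin (n + 1)) O →+*ᵍ homogeneousSubmodule (Fin (n + 1)) k)
        (hφ' : HomogeneousIdeal.irrelevant (homogeneousSubmodule (Fin (n + 1)) k) ≤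
          (HomogeneousIdeal.irrelevant (homogeneousSubmodule (Fin (n + 1)) O)).map φ),
        (∀ s, φ s = MvPolynomial.map π s) →
      ∀ (X₁ : Scheme.{0}) (σ₁ : X₁ ⟶ Proj (homogeneousSubmodule (Fin (n + 1)) O)) (S₁ : Set X₁),
        (∀ Q : (∀ X' : Scheme.{0}, (X' ⟶ Proj (homogeneousSubmodule (Fin (n + 1)) O)) → Set X' → Prop),
          Q (Proj (homogeneousSubmodule (Fin (n + 1)) O)) (𝟙 _) (Set.range (ι ≫ Proj.map φ hφ')) →
          (∀ (X' X'' : Scheme.{0}) (σ' : X' ⟶ Proj (homogeneousSubmodule (Fin (n + 1)) O)) (Y' : Set X')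
            (C : X'.IdealSheafData) (τ : X'' ⟶ X'), Q X' σ' Y' → IsBlowup τ C → Scheme.IsRegular C.subscheme →
            Flat (C.subschemeι ≫ σ' ≫ Proj.toSpecZero (homogeneousSubmodule (Fin (n + 1)) O) ≫
              Spec.map (CommRingCat.ofHom (algebraMap O (homogeneousSubmodule (Fin (n + 1)) O 0)))) →
            σ' '' (C.support : Set X') ⊆ {x | ¬ IsGenericPoint x (Set.range (ι ≫ Proj.map φ hφ'))} →
            (C.support : Set X') ∩ (σ' ≫ Proj.toSpecZero (homogeneousSubmodule (Fin (n + 1)) O) ≫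
              Spec.map (CommRingCat.ofHom (algebraMap O (homogeneousSubmodule (Fin (n + 1)) O 0)))) ⁻¹'
              {IsLocalRing.closedPoint O} ⊆ Y' →
            Q X'' (τ ≫ σ') (closure (τ ⁻¹' (Y' \ (C.support : Set X'))))) → Q X₁ σ₁ S₁) →
        IsLocallyNoetherian X₁ → Scheme.IsRegular X₁ →
        IsProper (σ₁ ≫ Proj.toSpecZero (homogeneousSubmodule (Fin (n + 1)) O) ≫
          Spec.map (CommRingCat.ofHom (algebraMap O (homogeneousSubmodule (Fin (n + 1)) O 0)))) →
        IsClosed S₁ → IsIrreducible S₁ →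
        S₁ ⊆ (σ₁ ≫ Proj.toSpecZero (homogeneousSubmodule (Fin (n + 1)) O) ≫
          Spec.map (CommRingCat.ofHom (algebraMap O (homogeneousSubmodule (Fin (n + 1)) O 0)))) ⁻¹'
          {IsLocalRing.closedPoint O} →
        ∀ D : ((vanishingIdeal (⟨closure S₁, isClosed_closure⟩ : Closeds X₁)).subscheme).IdealSheafData,
          (D.support : Set ↥(vanishingIdeal (⟨closure S₁, isClosed_closure⟩ : Closeds X₁)).subscheme) ⊆
            (Scheme.regularLocus (vanishingIdeal (⟨closure S₁, isClosed_closure⟩ : Closeds X₁)).subscheme)ᶜ →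
          Scheme.IsRegular D.subscheme →
          ∃ C : X₁.IdealSheafData, Scheme.IsRegular C.subscheme ∧
            Flat (C.subschemeι ≫ σ₁ ≫ Proj.toSpecZero (homogeneousSubmodule (Fin (n + 1)) O) ≫
              Spec.map (CommRingCat.ofHom (algebraMap O (homogeneousSubmodule (Fin (n + 1)) O 0)))) ∧
            (C.support : Set X₁) ∩ (σ₁ ≫ Proj.toSpecZero (homogeneousSubmodule (Fin (n + 1)) O) ≫
              Spec.map (CommRingCat.ofHom (algebraMap O (homogeneousSubmodule (Fin (n + 1)) O 0)))) ⁻¹'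
              {IsLocalRing.closedPoint O} ⊆ S₁ ∧
            C.comap (vanishingIdeal (⟨closure S₁, isClosed_closure⟩ : Closeds X₁)).subschemeι = D) :
    Theorems.EquisingularLift.ELNatAt p k n H ι :=
  Theorems.EquisingularLift.elNatAt_of_elNatOver hπ
    (elNatOver_of_regularCentreSequence k n H ι O π hπ hdown hMS)

end Summit.ResolutionOfSingularities.ResolutionOfSingularities.Cruxes.EquisingularLiftNat.Sections

end
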